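import Summits.HodgeConjecture.HodgeConjecture.Theorems.MarkmanPartnerTransportPicardThreeK3SquaresRealMultiplicationRanks
import Literature.AlgebraicGeometry.Motives.HodgeStructureK3TypeOddRank
import Literature.AlgebraicGeometry.Motives.HodgeStructureEndomorphismFieldAdjointConj
import Literature.AlgebraicGeometry.Motives.HodgeStructureEndAlgSemisimple
import Mathlib.FieldTheory.Galois.Basic

/-!
# Route MarkmanPartnerTransport · crux `PicardThreeK3Squares` (stmt-HodgeConjecture-19652) — «QUARTIC RIGIDITY»
# (chapter ROUTE-P1AL, cell `(3,4)` at `ρ(S) = 2`, abstract carriers): a K3-type Hodge structure of rank `20` carrying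
# a TOTALLY REAL QUARTIC Hodge endomorphism has totally real quartic endomorphism field (`ℓ = 5`)

Planner p1 g39 (TARGET «QUARTIC-SOCKET», 2026-08-28T16:26:10Z), prover seat hodge-nonav-19716-p2 (gen 7); sibling of
`…PicardThreeK3SquaresSepticRigidity` (cells `(2,3)`∕`(2,7)` at `ρ = 1`). For an irreducible polarized `ℚ`-Hodge
structure `H` of K3 type on `V` with `dim_ℚ V = 20` (the transcendental lattice of a projective K3 surface with
`ρ(S) = 2`) and an element `r` of the endomorphism field `E = End_Hdg(V)` whose minimal polynomial over `ℚ` has degree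
`4` and ALL of whose conjugates are real (`r` totally real: `φ r ∈ ℝ` for every `φ : E → ℂ` — load-bearing: a quartic
`ev ∉ ℝ`-type endomorphism does occur at rank `20` on CM points):

* `adjointEndAlg_one`, `adjointEndAlg_mul` — the adjoint (Rosati) involution `†` of a polarization is a `ℚ`-algebra
  AUTOMORPHISM of the FIELD `E` (Zarhin: `E` is commutative, so the anti-involution is multiplicative; used inside the
  proofs as an `AlgEquiv`, no definition is introduced);
* `even_finrank_adjoin_of_adjoint_ne`, `eight_dvd_finrank_endAlg_of_quartic_fixed` — **if `†` moves some element of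
  `E` and fixes an `r` of degree `4`, then `8 ∣ [E:ℚ]`**: `†` fixes `K = ℚ⟮r⟯` pointwise, so Huybrechts' parity device
  runs over `K` (`E = E₊ ⊕ E₋` as `K`-spaces, `b − b†` exchanging them), `[E:K]` is even and `[K:ℚ] = 4`;
* `finrank_eq_four_of_totallyReal_quartic` — **the rigidity**: `dim_ℚ V = 20` + such an `r` ⟹ `E` is totally real and
  `[E:ℚ] = 4` (so `E = ℚ(r)` and `dim_E V = 5`): if `E` were not totally real, `†` would move something
  (`adjointEndAlg_eq_self_iff_of_isField`) while fixing `r`, so `8 ∣ [E:ℚ] ∣ 20` — impossible; if `E` is totally real,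
  `4 ∣ [E:ℚ]` (tower over `ℚ⟮r⟯`) and `[E:ℚ] · m = 20` with `m ≥ 3` (van Geemen,
  `RealMultiplicationRanks.exists_three_le_finrank_eq_mul`) force `[E:ℚ] = 4`.

Fact-free on the abstract carriers (inputs: the tree THEOREMS `Zarhin1983_endAlg_isField_holds`,
`Vangeemen2008_three_mul_finrank_endAlg_le_holds`, Huybrechts' parity device); no definition, no sorry; `--supports stmt-HodgeConjecture-19652`. Nothing here proves the crux
or HC; rung F-H1 not moved. The surface reading (`ρ(S) = 2`, no CM, one cycle ⟹ HC⁴(S × S), HC⁴(S^{[2]})) is the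
sequel `…PicardThreeK3SquaresQuarticSocket`.

References: B. van Geemen, Michigan Math. J. 56 (2008) Lemma 3.2; D. Huybrechts, *Lectures on K3 Surfaces*, Ch. 3 §3.5
(the involution `a ↦ a'` and its fixed field `K₀`, `[K:K₀] ≤ 2`), Cor. 3.3.6; Yu. G. Zarhin, J. reine angew. Math. 341
(1983) Thm. 1.5.1; B. van Geemen, M. Schütt, Forum Math. Sigma 13 (2025) e2, Thm. 3.19 (the quartic cell).
-/

set_option linter.dupNamespace false

noncomputable section

universe u

namespace Summit.HodgeConjecture.HodgeConjecture.Theorems.MarkmanPartnerTransport.QuarticRigidity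

open scoped Manifold TensorProduct
open Module CategoryTheory MonoidalCategory CartesianMonoidalCategory Polynomial
open Literature.AlgebraicGeometry Literature.AlgebraicGeometry.Motives Literature.AlgebraicGeometry.HodgeTheory
open Literature.AlgebraicGeometry.Motives.HodgeStructure
open Literature.AlgebraicGeometry.Surfaces
open Literature.AlgebraicTopology.SingularHomology
open Summit.HodgeConjecture.HodgeConjecture.Theorems
open Summit.HodgeConjecture.HodgeConjecture.Theorems.NikulinTwinTransport
open Summit.HodgeConjecture.HodgeConjecture.Theorems.AnchorExistenceCMFloor
open Summit.HodgeConjecture.HodgeConjecture.Theorems.MarkmanPartnerTransport.RealMultiplicationRanks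

variable {V : Type u} [AddCommGroup V] [Module ℚ V] [Module.Finite ℚ V] {H : HodgeStructure V 2}

/-! ### The adjoint involution as a field automorphism -/

/-- **`†1 = 1`** in `End_Hdg(V)`. [cite: Huybrechts2016K3, Ch. 3 §3.3.5 eq. (3.3)] -/
theorem adjointEndAlg_one (ψ : H.Polarization) : ψ.adjointEndAlg 1 = 1 :=
  Subtype.ext (by rw [Polarization.coe_adjointEndAlg_apply]; exact ψ.adjoint_one)

/-- **`†` is multiplicative on the COMMUTATIVE algebra `End_Hdg(V)`** (`(ab)† = b†a† = a†b†`).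
[cite: Huybrechts2016K3, Ch. 3 Lemma 3.3.12 and Cor. 3.3.6] -/
theorem adjointEndAlg_mul (hF : IsField H.endAlg) (ψ : H.Polarization) (a b : H.endAlg) :
    ψ.adjointEndAlg (a * b) = ψ.adjointEndAlg a * ψ.adjointEndAlg b := by
  rw [ψ.isAntiInvolution_adjointEndAlg.map_mul, hF.mul_comm]

/-! ### `8 ∣ [E:ℚ]` when `†` fixes a quartic element but is not the identity -/

-- The `K`-module structure on the subalgebra `E = End_Hdg(V)` (a field only through `IsField.toField`) is found by
-- instance search well beyond the default budget; the statement itself is elementary linear algebra over `K`.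
set_option synthInstance.maxHeartbeats 160000 in
set_option maxHeartbeats 800000 in
/-- **`[E : ℚ⟮r⟯]` is EVEN when `†` fixes `r` but moves some element** (Huybrechts' parity device run over the
subfield `K = ℚ⟮r⟯`): `†` is `K`-linear (it fixes `K` pointwise, being a `ℚ`-algebra automorphism fixing `r`), so
`E = E₊ ⊕ E₋` as `K`-spaces, and multiplication by `b − b† ∈ E₋ ∖ 0` exchanges `E₊` and `E₋` injectively.
[cite: Huybrechts2016K3, Ch. 3 §3.5 (before Lemma 3.3.13) and Lemma 3.3.12] -/
theorem even_finrank_adjoin_of_adjoint_ne (hirr : H.IsIrreducible) (hF : IsField H.endAlg) (ψ : H.Polarization)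
    {r : H.endAlg} (hr : ψ.adjointEndAlg r = r) {b : H.endAlg} (hb : ψ.adjointEndAlg b ≠ b) :
    letI : Field H.endAlg := hF.toField
    Even (Module.finrank (IntermediateField.adjoin ℚ {r}) H.endAlg) := by
  classical
  letI : Field H.endAlg := hF.toField
  haveI : Module.Finite ℚ H.endAlg := finiteDimensional_endAlg H
  haveI : Nontrivial V := hirr.nontrivial
  have hint : IsIntegral ℚ r := Algebra.IsIntegral.isIntegral r
  set K : IntermediateField ℚ H.endAlg := IntermediateField.adjoin ℚ {r} with hKdef
  have hKk : Module.finrank ℚ K = (minpoly ℚ r).natDegree := by rw [hKdef, IntermediateField.adjoin.finrank hint]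
  haveI : Module.Finite K H.endAlg := inferInstance
  -- `†` as a `ℚ`-algebra automorphism `σ` of the field `E` (multiplicative since `E` is commutative)
  set σ : H.endAlg ≃ₐ[ℚ] H.endAlg := AlgEquiv.ofBijective
      (AlgHom.ofLinearMap ψ.adjointEndAlg (adjointEndAlg_one ψ) (adjointEndAlg_mul hF ψ))
      (Function.Involutive.bijective fun a => ψ.isAntiInvolution_adjointEndAlg.apply_apply a) with hσ
  have hσapp : ∀ a, σ a = ψ.adjointEndAlg a := fun a => rfl
  have hιι : ∀ x, ψ.adjointEndAlg (ψ.adjointEndAlg x) = x := (ψ.isAntiInvolution_adjointEndAlg).apply_apply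
  have hιmul : ∀ x y, ψ.adjointEndAlg (x * y) = ψ.adjointEndAlg x * ψ.adjointEndAlg y := adjointEndAlg_mul hF ψ
  have hcomm : ∀ x y : H.endAlg, x * y = y * x := hF.mul_comm
  -- `†` fixes `K = ℚ⟮r⟯` pointwise
  have hrfix : r ∈ IntermediateField.fixedField (Subgroup.zpowers σ) := by
    rw [IntermediateField.mem_fixedField_iff]
    intro f hf
    rw [Subgroup.mem_zpowers_iff] at hf
    obtain ⟨k, rfl⟩ := hf
    have hfix : σ r = r := by rw [hσapp]; exact hr
    have hpow : ∀ n : ℕ, (σ ^ n) r = r := by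
      intro n
      induction n with
      | zero => rw [pow_zero, AlgEquiv.one_apply]
      | succ n ih => rw [pow_succ, AlgEquiv.mul_apply, hfix, ih]
    rcases Int.eq_nat_or_neg k with ⟨n, rfl | rfl⟩
    · rw [zpow_natCast]; exact hpow n
    · rw [zpow_neg, zpow_natCast]
      calc (σ ^ n)⁻¹ r = (σ ^ n)⁻¹ ((σ ^ n) r) := by rw [hpow n]
        _ = r := by rw [← AlgEquiv.mul_apply, inv_mul_cancel, AlgEquiv.one_apply]
  have hKfix : ∀ k : K, ψ.adjointEndAlg (k : H.endAlg) = k := by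
    intro k
    have hKle : K ≤ IntermediateField.fixedField (Subgroup.zpowers σ) := by
      rw [hKdef]
      exact IntermediateField.adjoin_le_iff.mpr (Set.singleton_subset_iff.mpr hrfix)
    have hk := (IntermediateField.mem_fixedField_iff _ (k : H.endAlg)).1 (hKle k.2) σ (Subgroup.mem_zpowers σ)
    rwa [hσapp] at hk
  -- `†` as a `K`-linear map
  set ι : H.endAlg →ₗ[K] H.endAlg :=
    { toFun := ψ.adjointEndAlg
      map_add' := fun x y => map_add _ x y
      map_smul' := fun k x => by
        rw [RingHom.id_apply, IntermediateField.smul_def, IntermediateField.smul_def, smul_eq_mul, smul_eq_mul,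
          hιmul, hKfix] } with hιdef
  have hιapp : ∀ x, ι x = ψ.adjointEndAlg x := fun x => rfl
  -- the `±1`-eigenspaces over `K`
  set Ep : Submodule K H.endAlg := LinearMap.ker (ι - LinearMap.id) with hEp
  set Em : Submodule K H.endAlg := LinearMap.ker (ι + LinearMap.id) with hEm
  have hmemp : ∀ x, x ∈ Ep ↔ ι x = x := fun x => by
    rw [hEp, LinearMap.mem_ker, LinearMap.sub_apply, LinearMap.id_apply, sub_eq_zero]
  have hmemm : ∀ x, x ∈ Em ↔ ι x = -x := fun x => by
    rw [hEm, LinearMap.mem_ker, LinearMap.add_apply, LinearMap.id_apply, add_eq_zero_iff_eq_neg]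
  have hinf : Ep ⊓ Em = ⊥ := by
    rw [eq_bot_iff]
    intro x hx
    obtain ⟨hp, hm⟩ := Submodule.mem_inf.1 hx
    rw [hmemp] at hp
    rw [hmemm] at hm
    rw [Submodule.mem_bot]
    have h2 : (2 : K) • x = 0 := by
      rw [two_smul]
      nth_rewrite 2 [← hp]
      rw [hm, add_neg_cancel]
    exact (smul_eq_zero.1 h2).resolve_left (by norm_num)
  have hsup : Ep ⊔ Em = ⊤ := by
    rw [eq_top_iff]
    intro x _
    have hx : x = (1 / 2 : K) • (x + ι x) + (1 / 2 : K) • (x - ι x) := by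
      rw [← smul_add]
      have : x + ι x + (x - ι x) = (2 : K) • x := by rw [two_smul]; abel
      rw [this, smul_smul]
      norm_num
    rw [hx]
    refine Submodule.add_mem_sup (Submodule.smul_mem _ _ ?_) (Submodule.smul_mem _ _ ?_)
    · rw [hmemp, map_add, hιapp, hιapp, hιι, add_comm]
    · rw [hmemm, map_sub, hιapp, hιapp, hιι, neg_sub]
  have hdim : Module.finrank K H.endAlg = Module.finrank K Ep + Module.finrank K Em := by
    have h := Submodule.finrank_sup_add_finrank_inf_eq Ep Em
    rw [hinf, hsup, finrank_bot, add_zero, finrank_top] at h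
    exact h
  -- `c = b - b†` is a non-zero element of `E₋`
  set c : H.endAlg := b - ψ.adjointEndAlg b with hc
  have hc0 : c ≠ 0 := fun h => hb (sub_eq_zero.1 h).symm
  have hιc : ψ.adjointEndAlg c = -c := by rw [hc, map_sub, hιι, neg_sub]
  -- multiplication by `c` is `K`-linear, injective, and exchanges `E₊` and `E₋`
  set m : H.endAlg →ₗ[K] H.endAlg := LinearMap.mulLeft K c with hm
  have hmapp : ∀ x, m x = c * x := fun x => rfl
  have hminj : Function.Injective m := by
    intro x y hxy
    rw [hmapp, hmapp] at hxy
    exact mul_left_cancel₀ hc0 hxy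
  have hm_p : Ep.map m ≤ Em := by
    rintro _ ⟨x, hx, rfl⟩
    rw [SetLike.mem_coe, hmemp, hιapp] at hx
    rw [hmemm, hmapp, hιapp, hιmul, hx, hιc]
    exact neg_mul c x
  have hm_m : Em.map m ≤ Ep := by
    rintro _ ⟨x, hx, rfl⟩
    rw [SetLike.mem_coe, hmemm, hιapp] at hx
    rw [hmemp, hmapp, hιapp, hιmul, hx, hιc]
    exact neg_mul_neg c x
  have h1 : Module.finrank K Ep ≤ Module.finrank K Em :=
    ((Submodule.equivMapOfInjective m hminj Ep).finrank_eq).symm ▸ Submodule.finrank_mono hm_p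
  have h2 : Module.finrank K Em ≤ Module.finrank K Ep :=
    ((Submodule.equivMapOfInjective m hminj Em).finrank_eq).symm ▸ Submodule.finrank_mono hm_m
  rw [hdim, le_antisymm h1 h2]
  exact Even.add_self _

/-- **`†` non-trivial and fixing an element `r` of degree `4` ⟹ `8 ∣ [End_Hdg(V) : ℚ]`**: `[ℚ⟮r⟯:ℚ] = 4`
(`IntermediateField.adjoin.finrank`), `[E : ℚ⟮r⟯]` even (`even_finrank_adjoin_of_adjoint_ne`), tower law.
[cite: Huybrechts2016K3, Ch. 3 §3.5 (the fixed field `K₀`, `[K:K₀] ≤ 2`) and (3.2)] -/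
theorem eight_dvd_finrank_endAlg_of_quartic_fixed (hirr : H.IsIrreducible) (hF : IsField H.endAlg)
    (ψ : H.Polarization) {r : H.endAlg} (hr4 : (minpoly ℚ r).natDegree = 4) (hr : ψ.adjointEndAlg r = r)
    {b : H.endAlg} (hb : ψ.adjointEndAlg b ≠ b) : 8 ∣ Module.finrank ℚ H.endAlg := by
  classical
  have heven := even_finrank_adjoin_of_adjoint_ne hirr hF ψ hr hb
  letI : Field H.endAlg := hF.toField
  haveI : Module.Finite ℚ H.endAlg := finiteDimensional_endAlg H
  haveI : Nontrivial V := hirr.nontrivial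
  have hint : IsIntegral ℚ r := Algebra.IsIntegral.isIntegral r
  set K : IntermediateField ℚ H.endAlg := IntermediateField.adjoin ℚ {r} with hKdef
  have hK4 : Module.finrank ℚ K = 4 := by rw [hKdef, IntermediateField.adjoin.finrank hint, hr4]
  have htower : Module.finrank ℚ K * Module.finrank K H.endAlg = Module.finrank ℚ H.endAlg :=
    Module.finrank_mul_finrank ℚ K H.endAlg
  rw [hK4] at htower
  obtain ⟨j, hj⟩ := heven
  exact ⟨j, by rw [← htower, hj]; ring⟩

/-! ### The rigidity at rank `20` -/

/-- **Totally real branch**: `E` totally real with a degree-`4` element and `dim_ℚ V = 20` ⟹ `[E:ℚ] = 4` (`4 ∣ [E:ℚ]`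
by the tower over `ℚ⟮r⟯`; `[E:ℚ] · m = 20` with `m ≥ 3`, van Geemen). [cite: Vangeemen2008, Lemma 3.2]
[cite: Huybrechts2016K3, Ch. 3 §3.5 (3.2)] -/
theorem finrank_eq_four_of_totallyReal_of_quartic (hirr : H.IsIrreducible) (hK3 : H.IsOfK3Type)
    (ψ : H.Polarization) (h20 : Module.finrank ℚ V = 20) {r : H.endAlg} (hr4 : (minpoly ℚ r).natDegree = 4)
    (hreal : ∀ (φ : H.endAlg →+* ℂ) (a : H.endAlg), starRingEnd ℂ (φ a) = φ a) :
    Module.finrank ℚ H.endAlg = 4 := by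
  classical
  have hF : IsField H.endAlg := (Zarhin1983_endAlg_isField_holds H hirr hK3).1
  letI : Field H.endAlg := hF.toField
  haveI : Module.Finite ℚ H.endAlg := finiteDimensional_endAlg H
  haveI : Nontrivial V := hirr.nontrivial
  obtain ⟨m, hm3, hdim⟩ := exists_three_le_finrank_eq_mul hirr hK3 ψ hF hreal
  have hint : IsIntegral ℚ r := Algebra.IsIntegral.isIntegral r
  set K : IntermediateField ℚ H.endAlg := IntermediateField.adjoin ℚ {r} with hKdef
  have hK4 : Module.finrank ℚ K = 4 := by rw [hKdef, IntermediateField.adjoin.finrank hint, hr4]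
  have htower : Module.finrank ℚ K * Module.finrank K H.endAlg = Module.finrank ℚ H.endAlg :=
    Module.finrank_mul_finrank ℚ K H.endAlg
  rw [hK4] at htower
  -- `[E:ℚ] = 4 j`, `4 j m = 20`, `m ≥ 3` ⟹ `j = 1`
  rw [h20] at hdim
  set j := Module.finrank K H.endAlg with hj
  have hj1 : 1 ≤ j := by
    rcases Nat.eq_zero_or_pos j with h0 | h0
    · rw [h0, mul_zero] at htower; rw [← htower, zero_mul] at hdim; omega
    · exact h0
  have hjm : j * m ≤ 5 := by nlinarith
  have hj1' : j = 1 := by nlinarith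
  rw [← htower, hj1', mul_one]

/-- **«QUARTIC RIGIDITY».** For an irreducible polarized `ℚ`-Hodge structure of K3 type on `V` with `dim_ℚ V = 20`
and `r ∈ End_Hdg(V)` of degree `4` over `ℚ` all of whose conjugates are real: `End_Hdg(V)` is TOTALLY REAL and
`[End_Hdg(V) : ℚ] = 4` — so `E = ℚ(r)` is the totally real quartic field of `r` and `dim_E V = 5` (the cell `(3,4)`
shape `ℓ = 5`, van Geemen–Schütt Thm. 3.19). The CM alternative is excluded by `eight_dvd_finrank_endAlg_of_quartic_fixed`
(`8 ∤ 20`). [cite: Vangeemen2008, Lemma 3.2] [cite: Huybrechts2016K3, Ch. 3 §3.5 and Cor. 3.3.6]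
[cite: GeemenSchutt2023, Thm. 3.19] -/
theorem totallyReal_and_finrank_eq_four_of_quartic (hirr : H.IsIrreducible) (hK3 : H.IsOfK3Type)
    (ψ : H.Polarization) (h20 : Module.finrank ℚ V = 20) {r : H.endAlg} (hr4 : (minpoly ℚ r).natDegree = 4)
    (hr : ∀ φ : H.endAlg →+* ℂ, starRingEnd ℂ (φ r) = φ r) :
    (∀ (φ : H.endAlg →+* ℂ) (a : H.endAlg), starRingEnd ℂ (φ a) = φ a) ∧ Module.finrank ℚ H.endAlg = 4 := by
  obtain ⟨hF, ε, -, -⟩ := Zarhin1983_endAlg_isField_holds H hirr hK3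
  have hreal : ∀ (φ : H.endAlg →+* ℂ) (a : H.endAlg), starRingEnd ℂ (φ a) = φ a := by
    by_contra hne
    push Not at hne
    obtain ⟨φ, b, hb⟩ := hne
    have hbadj : ψ.adjointEndAlg b ≠ b := fun h => hb ((adjointEndAlg_eq_self_iff_of_isField hF ψ φ b).1 h)
    have hradj : ψ.adjointEndAlg r = r := (adjointEndAlg_eq_self_iff_of_isField hF ψ φ r).2 (hr φ)
    have h8 := eight_dvd_finrank_endAlg_of_quartic_fixed hirr hF ψ hr4 hradj hbadj
    have h20' := finrank_endAlg_dvd_finrank hirr hK3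
    rw [h20] at h20'
    -- `8 ∣ [E:ℚ] ∣ 20` is impossible
    exact absurd (h8.trans h20') (by norm_num)
  exact ⟨hreal, finrank_eq_four_of_totallyReal_of_quartic hirr hK3 ψ h20 hr4 hreal⟩

/-! ### Appended: the eigenvalue form (hypotheses read through the `(2,0)`-character `ε`) -/

omit [Module.Finite ℚ V] in
/-- **Conjugates of `φ r` are roots of the minimal polynomial of `ε r`**: for ring homomorphisms `φ : E → ℂ` and an
injective `ℚ`-algebra map `ε : E → ℂ`, `(minpoly_ℚ (ε r))(φ r) = 0` (`minpoly.algHom_eq`; a ring map out of a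
`ℚ`-algebra commutes with the structure maps, `ℚ →+* ℂ` being unique). [folklore] -/
theorem aeval_apply_minpoly_algHom_eq_zero (ε : H.endAlg →ₐ[ℚ] ℂ) (hε : Function.Injective ε)
    (φ : H.endAlg →+* ℂ) (r : H.endAlg) : Polynomial.aeval (φ r) (minpoly ℚ (ε r)) = 0 := by
  rw [minpoly.algHom_eq ε hε]
  have hcomp : φ.comp (algebraMap ℚ H.endAlg) = algebraMap ℚ ℂ := Subsingleton.elim _ _
  have h : Polynomial.aeval (φ r) (minpoly ℚ r) = φ (Polynomial.aeval r (minpoly ℚ r)) := by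
    rw [Polynomial.aeval_def, Polynomial.aeval_def, Polynomial.hom_eval₂, hcomp]
  rw [h, minpoly.aeval, map_zero]

/-- **«QUARTIC RIGIDITY», eigenvalue form** — the shape the K3 consumer meets (the marking picture reads a Hodge
endomorphism `e` as `r = e|_T ∈ E` with `ε r = ev`, the eigenvalue on the `2`-form): for `H` irreducible polarized of
K3 type with `dim_ℚ V = 20`, `ε : E →ₐ[ℚ] ℂ` injective and `r ∈ E` with `deg minpoly_ℚ (ε r) = 4` and every complex
root of `minpoly_ℚ (ε r)` real, `E` is totally real and `[E:ℚ] = 4`. [cite: Vangeemen2008, Lemma 3.2]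
[cite: Huybrechts2016K3, Ch. 3 §3.5 and Cor. 3.3.6] [cite: GeemenSchutt2023, Thm. 3.19] -/
theorem totallyReal_and_finrank_eq_four_of_quartic_algHom (hirr : H.IsIrreducible) (hK3 : H.IsOfK3Type)
    (ψ : H.Polarization) (h20 : Module.finrank ℚ V = 20) (ε : H.endAlg →ₐ[ℚ] ℂ) (hε : Function.Injective ε)
    {r : H.endAlg} (hr4 : (minpoly ℚ (ε r)).natDegree = 4)
    (hr : ∀ z : ℂ, Polynomial.aeval z (minpoly ℚ (ε r)) = 0 → starRingEnd ℂ z = z) :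
    (∀ (φ : H.endAlg →+* ℂ) (a : H.endAlg), starRingEnd ℂ (φ a) = φ a) ∧ Module.finrank ℚ H.endAlg = 4 := by
  have hr4' : (minpoly ℚ r).natDegree = 4 := by rw [← minpoly.algHom_eq ε hε]; exact hr4
  exact totallyReal_and_finrank_eq_four_of_quartic hirr hK3 ψ h20 hr4'
    fun φ => hr (φ r) (aeval_apply_minpoly_algHom_eq_zero ε hε φ r)

end Summit.HodgeConjecture.HodgeConjecture.Theorems.MarkmanPartnerTransport.QuarticRigidity

end
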